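import Summits.Ventures.PercRepro.C026C028GluingParts
import Summits.Ventures.PercRepro.C026ProbeTransfer

/-!
# Deleting a surely-closed edge (p6, gen 15; bookkeeping for the graph ↔ state dictionary)

An edge `e` with `p e = 0` is closed on every positive-weight configuration, so the connections of `G`
are those of the part `G.part (· ≠ e) true` — the graph without `e` — and every row of the law of
`(G, p)` equals the row of that part under the restricted weights (`law3_eq_part_of_zero`).  With it a
gluing structure may be read on `G` after a fractional edge is set to `0` (the deletion minor of the
one-edge induction), e.g. the K₃-hub's deletion minor is the gluing of its two branches.
-/

namespace PercRepro

/-- The colouring «not `e`». -/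
def notEdge {E : Type*} [DecidableEq E] (e : E) : E → Bool := fun e' => decide (e' ≠ e)

namespace MultiGraph

variable {V E : Type*} (G : MultiGraph V E) [Fintype E] [DecidableEq E]

omit [Fintype E] in
/-- With `e` closed, a connection of `G` is a connection of the part without `e`. -/
theorem conn_part_notEdge_of_closed {e : E} {ω : Config E} (he : ω e = false) {u v : V}
    (h : G.Conn ω u v) : (G.part (notEdge e) true).Conn (sideRestrict ω (notEdge e) true) u v := by
  refine Conn.induction (motive := fun v => (G.part (notEdge e) true).Conn
    (sideRestrict ω (notEdge e) true) u v) (Conn.refl _ _ u) ?_ h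
  intro x y _ hadj ih
  obtain ⟨e', he', hends⟩ := hadj
  have hne : e' ≠ e := by
    rintro rfl
    rw [he] at he'
    exact absurd he' (by decide)
  have hcol : notEdge e e' = true := by simp [notEdge, hne]
  have hstep : (G.part (notEdge e) (notEdge e e')).OpenAdj
      (sideRestrict ω (notEdge e) (notEdge e e')) x y :=
    G.openAdj_part_of_open he' hends
  rw [hcol] at hstep
  exact ih.tail hstep

omit [Fintype E] in
/-- With `e` closed, connectivity in `G` is connectivity in the part without `e`. -/
theorem conn_iff_part_notEdge_of_closed {e : E} {ω : Config E} (he : ω e = false) (u v : V) :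
    G.Conn ω u v ↔ (G.part (notEdge e) true).Conn (sideRestrict ω (notEdge e) true) u v :=
  ⟨G.conn_part_notEdge_of_closed he, fun h => Conn.of_part h⟩

/-- **Deleting a surely-closed edge**: every row of the law of `(G, p)` with `p e = 0` is the row of the
part without `e` under the restricted weights. -/
theorem law3_eq_part_of_zero {p : E → ℝ} (hp : IsProb p) {e : E} (he : p e = 0) (a b c : V)
    (s : Fin 5) :
    G.law3 p a b c s =
      (G.part (notEdge e) true).law3 (fun e' : {e' // notEdge e e' = true} => p e'.1) a b c s := by
  unfold law3
  have h := prob_sideRestrict_eq_restrict p (notEdge e) true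
    (fun τ => τ ∈ (G.part (notEdge e) true).partitionEvent ![a, b, c] (rgs3 s))
  simp only [Set.setOf_mem_eq] at h
  rw [← h]
  refine prob_eq_of_eqOn_pos hp fun ω hω => ?_
  have hcl : ω e = false := eq_false_of_weight_pos hω he
  simp only [Set.mem_setOf_eq, G.mem_partitionEvent_three a b c,
    (G.part (notEdge e) true).mem_partitionEvent_three a b c,
    G.conn_iff_part_notEdge_of_closed hcl]

/-- The same for the C-028 defect and ROW C-028(c). -/
theorem C028At_iff_part_of_zero {p : E → ℝ} (hp : IsProb p) {e : E} (he : p e = 0) (a b c : V) :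
    G.C028At p a b c ↔
      (G.part (notEdge e) true).C028At (fun e' : {e' // notEdge e e' = true} => p e'.1) a b c := by
  have hr := G.law3_eq_part_of_zero hp he a b c
  unfold C028At c028Cov
  rw [hr 0, hr 1, hr 2, hr 3]

/-! ### Sure-cluster helpers for the contracted minor -/

omit [Fintype E] [DecidableEq E] in
/-- A surely-open edge joins its ends surely. -/
theorem sureConn_of_sure_edge {p : E → ℝ} {f : E} (hf : p f = 1) {x y : V}
    (hj : (G.fst f = x ∧ G.snd f = y) ∨ (G.fst f = y ∧ G.snd f = x)) : G.SureConn p x y := by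
  have hs : sureConfig p f = true := by simp [sureConfig, hf]
  exact Conn.of_openAdj ⟨f, hs, hj⟩

omit [Fintype E] in
/-- Forcing an edge open enlarges the sure clusters. -/
theorem sureConn_update_one_of_sureConn {p : E → ℝ} (f : E) {u v : V} (h : G.SureConn p u v) :
    G.SureConn (Function.update p f 1) u v := by
  unfold SureConn at h ⊢
  refine h.mono (fun e' he' => ?_)
  by_cases hef : e' = f
  · subst hef; simp [sureConfig]
  · simpa [sureConfig, Function.update_of_ne hef] using he'

end MultiGraph

end PercRepro
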